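import Summits.QuantumFields.YangMills.Theorems.BalabanUVNodesN15CurvedGluingCubeDressedGeneralGauge
import HarnessLib

/-!
# Route «BalabanUVNodes» (cluster K4 «SpineRates»), Track-A DAG node N15 = NE2, BACKGROUND LAYER — PER-CUBE GAUGES AT THE OBJECT LEVEL: the gauge action on the 1-JET carrier and the
# NATURALITY of the dressed device — feeding the conjugated flat pair `Ŝ^W = Ĵ_W∘Ŝ∘M_{Wᵀ}` and the conjugated jet perturbation `V̂^W = M_W∘V̂∘Ĵ_{Wᵀ}` into dag-n15-c's `bgPropV` RETURNS
# the conjugated dressed pair `Ĵ_W∘X̂∘M_{Wᵀ}`; the species `unstackM C A` conjugates into the species of the conjugated coefficients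

Cell `pub-ymgap`, seat `pub-ymgap-dag-n15-w2` (WIDTH SEAT 2∕3 on node N15, director-ym №197 ∕ HUMAN RULING D-0149), g4, OFFER (o3) of the ASK-NEXT line (own lineage: per-cube gauges
p618904 ∕ p620732 ∕ p622505).  `bears_on: R4∕N15 · K3⁷ SpineGivenEndpointR13SepCoPH (stmt-QuantumFields-20544)`.  Filed `--supports stmt-QuantumFields-20544 --as helper` — COUNT-NEUTRAL.
ONE plumbing `def` (`jetMulOp`, the gauge action on the jet carrier) ⇒ definition lane; 0 `sorry`.  Imports BY NAME p618904 `…DressedGeneralGauge` (`mmulOp_transpose_comp_cancel`-type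
cancellations through g0; dag-n15-c B1a∕B2∕M-layer `bgPropV`, `stack`, `projO`, `unstackM`, n15-b `mmulOp`, `mmulOp_comp_mmulOp`); nothing in the tree is modified, no landed name re-declared.

WHY.  p618904 transfers the ROWS of a cube engine between gauges; this file shows the OBJECT does too: n15-w3's dressed pair `X̂ = (1 − ŜV̂)⁻¹Ŝ` (B1a `bgPropV (stack G₀ D) V̂`) built from the
conjugated inputs IS the conjugate of the dressed pair — so a knit may move n15-w3's files 16–33 between the (3.35) local gauge and the global gauge at the level of the objects
themselves, not only of their letters.  The jet carrier `(X × ι) × Option K` carries the gauge action `Ĵ_W` (`jetMulOp W`: `W(x)` on every jet component), built from B2's `stack`∕`projO`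
without leaving the lineage's vocabulary.
* §1 `jetMulOp` + `jetMulOp_apply`, `projO_comp_jetMulOp` (`pr_k∘Ĵ_W = M_W∘pr_k`), `jetMulOp_comp_stack` (`Ĵ_W∘(G, D) = (M_WG, M_WD)`), `jetMulOp_comp_jetMulOp` (`Ĵ_{W₁}Ĵ_{W₂} = Ĵ_{W₁W₂}`),
  `jetMulOp_one`, `jetMulOp_transpose_comp` ∕ `jetMulOp_comp_transpose` (`Ĵ_{Wᵀ}Ĵ_W = 1 = Ĵ_WĴ_{Wᵀ}`), ★ `stack_gaugeConj` (`(G^W, D^W) = Ĵ_W∘(G, D)∘M_{Wᵀ}`), ★ `unstackM_gaugeConj`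
  (`M_W∘V(C, A)∘Ĵ_{Wᵀ} = V(WCWᵀ, WAWᵀ)` — the species of the conjugated coefficients, cf. g0 `covSpeciesOpM_trGaugeAct`);
* §2 ★★ `toMatrix_one_sub_gaugeConj` (`1 − [Ĵ_W(ŜV̂)Ĵ_{Wᵀ}] = [Ĵ_W](1 − [ŜV̂])[Ĵ_{Wᵀ}]`), ★★ `isUnit_one_sub_gaugeConj` (the unit hypothesis transfers), ★★★ `bgPropV_gaugeConj`
  (`bgPropV (Ĵ_WŜM_{Wᵀ}) (M_WV̂Ĵ_{Wᵀ}) = Ĵ_W∘bgPropV Ŝ V̂∘M_{Wᵀ}` under `IsUnit (1 − [ŜV̂])`: the Neumann inverse conjugates), ★★ `dressed_gaugeConj` (every component: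
  `pr_k∘X̂(Ŝ^W, V̂^W) = M_W∘(pr_k∘X̂)∘M_{Wᵀ}`) and ★★ `dressedCube_gaugeConj` (n15-w3 file 23's cube `pr₀∘bgPropV (stack G₀ D) V̂` at the conjugated data = the conjugated cube).

HONEST FRAMING ∕ LIMITS.  Finite-dimensional linear algebra (identities only, no letters); nothing of [B9] asserted ((3.35) p.396, (3.63)–(3.65) pp.402–403 = SHAPES ∕ MECHANISM).  It does NOT say
that the lineage's flat inputs are themselves gauge covariant (the flat Laplacian does not commute with `M_W`): the covariance that matters for (3.35) is p618904's, at the level of the full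
operator `Δ_{gaugePair R} + P` and its parametrix; this file is the algebraic naturality of the device.  NE2⁺ NOT PRINTED, NOT proved; N15 NOT discharged; K3⁷ OPEN, not claimed, skeleton v5
untouched; counts of record UNMOVED (typed 28∕28 · discharged 5∕27 · A 5∕28); no summit statement is proved here; one finite 𝕋⁴ at fixed ε — NOT ℝ⁴ ∕ OS ∕ mass gap ∕ Clay; R4 closes the
conditional finite-𝕋⁴ rung `BalabanLadder.UV` only.  Restate-immune (no Theses import).
-/

set_option autoImplicit false

noncomputable section
open scoped BigOperators Matrix

namespace Summit.QuantumFields.YangMills.BalabanUVNodes.N15.CurvedSpecies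

open Literature.MathematicalPhysics.QuantumFieldTheory.Balaban1983to89
open Summit.QuantumFields.YangMills.BalabanUVNodes.N15.MatrixSpecies (mmulOp mmulOp_apply mmulOp_comp_mmulOp)
open Summit.QuantumFields.YangMills.BalabanUVNodes.N15.BackgroundLayer (stack projO projO_apply stack_apply_none stack_apply_some unstackM bgPropV mulVecLin_toMatrix'
  mulVecLin_toMatrix'_rect linearMap_sum_comp linearMap_comp_sum)

variable {X ι K : Type} [Fintype ι]

/-! ## §1 The gauge action on the jet carrier -/

section Jet

/-- THE GAUGE ACTION ON THE 1-JET CARRIER `(X × ι) × Option K`: `W(x)` acts on every jet component (`none` = the field, `some k` = its `k`-th derived piece) — B2's `stack` of the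
conjugated components. [cite: Balaban1985BackgroundPropagators, (3.35) p.396 (the gauge acts on `λ` and on `∇_U λ` alike: shape)] -/
def jetMulOp (W : X → Matrix ι ι ℝ) : ((X × ι) × Option K → ℝ) →ₗ[ℝ] ((X × ι) × Option K → ℝ) :=
  stack (mmulOp W ∘ₗ projO none) (fun k => mmulOp W ∘ₗ projO (some k))

variable (W : X → Matrix ι ι ℝ)

/-- Pointwise form: `(Ĵ_W f)((x, i), k) = Σ_j W(x)_{ij} f((x, j), k)`. [folklore] -/
theorem jetMulOp_apply (f : (X × ι) × Option K → ℝ) (p : X × ι) (k : Option K) :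
    jetMulOp W f (p, k) = ∑ j, W p.1 p.2 j * f ((p.1, j), k) := by
  rcases k with _ | k
  · simp only [jetMulOp, stack_apply_none, LinearMap.comp_apply, mmulOp_apply, projO_apply]
  · simp only [jetMulOp, stack_apply_some, LinearMap.comp_apply, mmulOp_apply, projO_apply]

/-- COMPONENTS OF THE JET ACTION: `pr_k ∘ Ĵ_W = M_W ∘ pr_k`. [folklore] -/
theorem projO_comp_jetMulOp (k : Option K) : projO k ∘ₗ jetMulOp (K := K) W = mmulOp W ∘ₗ projO k := by
  refine LinearMap.ext fun f => funext fun p => ?_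
  simp only [LinearMap.comp_apply, projO_apply, jetMulOp_apply, mmulOp_apply]

/-- THE JET ACTION ON A STACK: `Ĵ_W ∘ (G, (D_k)_k) = (M_W∘G, (M_W∘D_k)_k)`. [folklore] -/
theorem jetMulOp_comp_stack {F : Type} [AddCommGroup F] [Module ℝ F] (G : F →ₗ[ℝ] (X × ι → ℝ)) (D : K → F →ₗ[ℝ] (X × ι → ℝ)) :
    jetMulOp W ∘ₗ stack G D = stack (mmulOp W ∘ₗ G) (fun k => mmulOp W ∘ₗ D k) := by
  refine LinearMap.ext fun f => funext fun q => ?_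
  obtain ⟨p, k⟩ := q
  rcases k with _ | k
  · simp only [LinearMap.comp_apply, jetMulOp_apply, stack_apply_none, mmulOp_apply]
  · simp only [LinearMap.comp_apply, jetMulOp_apply, stack_apply_some, mmulOp_apply]

/-- Jet actions multiply: `Ĵ_{W₁} ∘ Ĵ_{W₂} = Ĵ_{W₁W₂}`. [folklore] -/
theorem jetMulOp_comp_jetMulOp (W₁ W₂ : X → Matrix ι ι ℝ) : jetMulOp (K := K) W₁ ∘ₗ jetMulOp W₂ = jetMulOp (fun x => W₁ x * W₂ x) := by
  refine LinearMap.ext fun f => funext fun q => ?_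
  obtain ⟨p, k⟩ := q
  simp only [LinearMap.comp_apply, jetMulOp_apply, Matrix.mul_apply, Finset.sum_mul, Finset.mul_sum]
  rw [Finset.sum_comm]
  exact Finset.sum_congr rfl fun j _ => Finset.sum_congr rfl fun l _ => by ring

variable [DecidableEq ι]

/-- The trivial jet action is the identity. [folklore] -/
theorem jetMulOp_one : jetMulOp (K := K) (fun _ : X => (1 : Matrix ι ι ℝ)) = LinearMap.id := by
  refine LinearMap.ext fun f => funext fun q => ?_
  obtain ⟨p, k⟩ := q
  simp only [jetMulOp_apply, LinearMap.id_apply, Matrix.one_apply, ite_mul, one_mul, zero_mul, Finset.sum_ite_eq, Finset.mem_univ, if_true]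

/-- `Ĵ_{Wᵀ} ∘ Ĵ_W = 1` for `WᵀW = 1`. [folklore] -/
theorem jetMulOp_transpose_comp (hW' : ∀ x, (W x)ᵀ * W x = 1) : jetMulOp (K := K) (fun x => (W x)ᵀ) ∘ₗ jetMulOp W = LinearMap.id := by
  rw [jetMulOp_comp_jetMulOp, show (fun x => (W x)ᵀ * W x) = fun _ => (1 : Matrix ι ι ℝ) from funext hW', jetMulOp_one]

/-- `Ĵ_W ∘ Ĵ_{Wᵀ} = 1` for `WWᵀ = 1`. [folklore] -/
theorem jetMulOp_comp_transpose (hW : ∀ x, W x * (W x)ᵀ = 1) : jetMulOp (K := K) W ∘ₗ jetMulOp (fun x => (W x)ᵀ) = LinearMap.id := by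
  rw [jetMulOp_comp_jetMulOp, show (fun x => W x * (W x)ᵀ) = fun _ => (1 : Matrix ι ι ℝ) from funext hW, jetMulOp_one]

omit [DecidableEq ι] in
/-- ★ **THE CONJUGATED FLAT PAIR IS THE JET-CONJUGATE OF THE FLAT PAIR**: `(M_WGM_{Wᵀ}, (M_WD_kM_{Wᵀ})_k) = Ĵ_W ∘ (G, D) ∘ M_{Wᵀ}`.
[cite: Balaban1985BackgroundPropagators, (3.35) p.396, (3.63) p.402 (shapes)] -/
theorem stack_gaugeConj (G : (X × ι → ℝ) →ₗ[ℝ] (X × ι → ℝ)) (D : K → (X × ι → ℝ) →ₗ[ℝ] (X × ι → ℝ)) :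
    stack (mmulOp W ∘ₗ G ∘ₗ mmulOp (fun x => (W x)ᵀ)) (fun k => mmulOp W ∘ₗ D k ∘ₗ mmulOp (fun x => (W x)ᵀ)) =
      jetMulOp W ∘ₗ stack G D ∘ₗ mmulOp (fun x => (W x)ᵀ) := by
  refine LinearMap.ext fun f => funext fun q => ?_
  obtain ⟨p, k⟩ := q
  rcases k with _ | k
  · simp only [stack_apply_none, LinearMap.comp_apply, jetMulOp_apply, mmulOp_apply]
  · simp only [stack_apply_some, LinearMap.comp_apply, jetMulOp_apply, mmulOp_apply]

variable [Fintype K]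

omit [DecidableEq ι] [Fintype K] in
/-- One species term under the gauge change: `M_W∘(M_B∘pr_k)∘Ĵ_{Wᵀ} = M_{WBWᵀ}∘pr_k`. [folklore] -/
theorem mmulOp_comp_term_comp_jetMulOp (B : X → Matrix ι ι ℝ) (k : Option K) :
    mmulOp W ∘ₗ (mmulOp B ∘ₗ projO k) ∘ₗ jetMulOp (fun x => (W x)ᵀ) = mmulOp (fun x => W x * B x * (W x)ᵀ) ∘ₗ projO k := by
  rw [LinearMap.comp_assoc, projO_comp_jetMulOp, ← LinearMap.comp_assoc, ← LinearMap.comp_assoc, mmulOp_comp_mmulOp, mmulOp_comp_mmulOp]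

omit [DecidableEq ι] in
/-- ★ **THE SPECIES OF THE CONJUGATED COEFFICIENTS**: `M_W ∘ V(C, A) ∘ Ĵ_{Wᵀ} = V(WCWᵀ, (WA_kWᵀ)_k)` for the M-layer's `unstackM C A = M_C∘pr₀ + Σ_k M_{A_k}∘pr_k` — the jet-level
companion of g0 `covSpeciesOpM_trGaugeAct`. [cite: Balaban1985BackgroundPropagators, (3.52)–(3.53) p.400, (3.35) p.396 (shapes)] -/
theorem unstackM_gaugeConj (C : X → Matrix ι ι ℝ) (A : K → X → Matrix ι ι ℝ) :
    mmulOp W ∘ₗ unstackM C A ∘ₗ jetMulOp (fun x => (W x)ᵀ) = unstackM (fun x => W x * C x * (W x)ᵀ) (fun k x => W x * A k x * (W x)ᵀ) := by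
  unfold unstackM
  rw [LinearMap.add_comp, LinearMap.comp_add, linearMap_sum_comp, linearMap_comp_sum, mmulOp_comp_term_comp_jetMulOp]
  exact congrArg _ (Finset.sum_congr rfl fun μ _ => mmulOp_comp_term_comp_jetMulOp W (A μ) (some μ))

end Jet

/-! ## §2 The Neumann inverse conjugates: the dressed pair at conjugated data is the conjugated dressed pair -/

section Neumann

variable [Fintype X] [DecidableEq X] [DecidableEq ι] [Fintype K] [DecidableEq K] (W : X → Matrix ι ι ℝ)
  (S : (X × ι → ℝ) →ₗ[ℝ] ((X × ι) × Option K → ℝ)) (V : ((X × ι) × Option K → ℝ) →ₗ[ℝ] (X × ι → ℝ))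

omit [Fintype X] [DecidableEq X] [Fintype K] [DecidableEq K] in
/-- The step of the conjugated data: `(Ĵ_WŜM_{Wᵀ})∘(M_WV̂Ĵ_{Wᵀ}) = Ĵ_W∘(ŜV̂)∘Ĵ_{Wᵀ}` (`WᵀW = 1`). [folklore] -/
theorem step_gaugeConj (hW' : ∀ x, (W x)ᵀ * W x = 1) :
    (jetMulOp W ∘ₗ S ∘ₗ mmulOp (fun x => (W x)ᵀ)) ∘ₗ (mmulOp W ∘ₗ V ∘ₗ jetMulOp (fun x => (W x)ᵀ)) = jetMulOp W ∘ₗ (S ∘ₗ V) ∘ₗ jetMulOp (fun x => (W x)ᵀ) := by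
  simp only [LinearMap.comp_assoc, mmulOp_transpose_comp_cancel W hW']

/-- ★★ **THE UNIT MATRIX CONJUGATES**: `1 − [Ĵ_W(ŜV̂)Ĵ_{Wᵀ}] = [Ĵ_W]·(1 − [ŜV̂])·[Ĵ_{Wᵀ}]` (`WWᵀ = 1`). [cite: Balaban1985BackgroundPropagators, (3.63)–(3.64) pp.402–403 (mechanism)] -/
theorem toMatrix_one_sub_gaugeConj (hW : ∀ x, W x * (W x)ᵀ = 1) (A : ((X × ι) × Option K → ℝ) →ₗ[ℝ] ((X × ι) × Option K → ℝ)) :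
    1 - LinearMap.toMatrix' (jetMulOp W ∘ₗ A ∘ₗ jetMulOp (fun x => (W x)ᵀ)) =
      LinearMap.toMatrix' (jetMulOp (K := K) W) * (1 - LinearMap.toMatrix' A) * LinearMap.toMatrix' (jetMulOp (K := K) fun x => (W x)ᵀ) := by
  rw [Matrix.mul_sub, Matrix.sub_mul, Matrix.mul_one, ← LinearMap.toMatrix'_comp, jetMulOp_comp_transpose W hW, LinearMap.toMatrix'_id, ← LinearMap.toMatrix'_comp,
    ← LinearMap.toMatrix'_comp, LinearMap.comp_assoc]

/-- ★★ **THE UNIT HYPOTHESIS TRANSFERS**: `IsUnit (1 − [ŜV̂]) ⟹ IsUnit (1 − [Ĵ_W(ŜV̂)Ĵ_{Wᵀ}])` (`WWᵀ = WᵀW = 1`). [cite: Balaban1985BackgroundPropagators, (3.63)–(3.64) pp.402–403 (mechanism)] -/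
theorem isUnit_one_sub_gaugeConj (hW : ∀ x, W x * (W x)ᵀ = 1) (hW' : ∀ x, (W x)ᵀ * W x = 1) {A : ((X × ι) × Option K → ℝ) →ₗ[ℝ] ((X × ι) × Option K → ℝ)}
    (hunit : IsUnit (1 - LinearMap.toMatrix' A)) : IsUnit (1 - LinearMap.toMatrix' (jetMulOp W ∘ₗ A ∘ₗ jetMulOp (fun x => (W x)ᵀ))) := by
  have hJ : LinearMap.toMatrix' (jetMulOp (K := K) W) * LinearMap.toMatrix' (jetMulOp (K := K) fun x => (W x)ᵀ) = 1 := by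
    rw [← LinearMap.toMatrix'_comp, jetMulOp_comp_transpose W hW, LinearMap.toMatrix'_id]
  have hJ' : LinearMap.toMatrix' (jetMulOp (K := K) fun x => (W x)ᵀ) * LinearMap.toMatrix' (jetMulOp (K := K) W) = 1 := by
    rw [← LinearMap.toMatrix'_comp, jetMulOp_transpose_comp W hW', LinearMap.toMatrix'_id]
  have hJu : IsUnit (LinearMap.toMatrix' (jetMulOp (K := K) W)) :=
    (Matrix.isUnit_iff_isUnit_det _).2 (isUnit_iff_exists_inv.mpr ⟨_, by rw [← Matrix.det_mul, hJ, Matrix.det_one]⟩)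
  have hJ'u : IsUnit (LinearMap.toMatrix' (jetMulOp (K := K) fun x => (W x)ᵀ)) :=
    (Matrix.isUnit_iff_isUnit_det _).2 (isUnit_iff_exists_inv.mpr ⟨_, by rw [← Matrix.det_mul, hJ', Matrix.det_one]⟩)
  rw [toMatrix_one_sub_gaugeConj W hW A]
  exact (hJu.mul hunit).mul hJ'u

/-- ★★★ **THE DRESSED PAIR AT CONJUGATED DATA IS THE CONJUGATED DRESSED PAIR**: `bgPropV (Ĵ_WŜM_{Wᵀ}) (M_WV̂Ĵ_{Wᵀ}) = Ĵ_W ∘ bgPropV Ŝ V̂ ∘ M_{Wᵀ}` whenever `1 − [ŜV̂]` is a unit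
(`WWᵀ = WᵀW = 1`) — `(1 − Ĵ(ŜV̂)Ĵ⁻¹)⁻¹ĴŜ = Ĵ(1 − ŜV̂)⁻¹Ŝ`. [cite: Balaban1985BackgroundPropagators, (3.64)–(3.65) pp.402–403 (shape), (3.35) p.396] -/
theorem bgPropV_gaugeConj (hW : ∀ x, W x * (W x)ᵀ = 1) (hW' : ∀ x, (W x)ᵀ * W x = 1) (hunit : IsUnit (1 - LinearMap.toMatrix' (S ∘ₗ V))) :
    bgPropV (jetMulOp W ∘ₗ S ∘ₗ mmulOp (fun x => (W x)ᵀ)) (mmulOp W ∘ₗ V ∘ₗ jetMulOp (fun x => (W x)ᵀ)) = jetMulOp W ∘ₗ bgPropV S V ∘ₗ mmulOp (fun x => (W x)ᵀ) := by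
  have hJ : LinearMap.toMatrix' (jetMulOp (K := K) W) * LinearMap.toMatrix' (jetMulOp (K := K) fun x => (W x)ᵀ) = 1 := by
    rw [← LinearMap.toMatrix'_comp, jetMulOp_comp_transpose W hW, LinearMap.toMatrix'_id]
  have hJ'J : LinearMap.toMatrix' (jetMulOp (K := K) fun x => (W x)ᵀ) * LinearMap.toMatrix' (jetMulOp (K := K) W) = 1 := by
    rw [← LinearMap.toMatrix'_comp, jetMulOp_transpose_comp W hW', LinearMap.toMatrix'_id]
  have hstep : LinearMap.toMatrix' ((jetMulOp W ∘ₗ S ∘ₗ mmulOp (fun x => (W x)ᵀ)) ∘ₗ (mmulOp W ∘ₗ V ∘ₗ jetMulOp (fun x => (W x)ᵀ))) =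
      LinearMap.toMatrix' (jetMulOp (K := K) W) * LinearMap.toMatrix' (S ∘ₗ V) * LinearMap.toMatrix' (jetMulOp (K := K) fun x => (W x)ᵀ) := by
    rw [step_gaugeConj W S V hW', LinearMap.toMatrix'_comp, LinearMap.toMatrix'_comp, Matrix.mul_assoc]
  have hinv : (1 - LinearMap.toMatrix' (jetMulOp (K := K) W) * LinearMap.toMatrix' (S ∘ₗ V) * LinearMap.toMatrix' (jetMulOp (K := K) fun x => (W x)ᵀ))⁻¹ =
      LinearMap.toMatrix' (jetMulOp (K := K) W) * (1 - LinearMap.toMatrix' (S ∘ₗ V))⁻¹ * LinearMap.toMatrix' (jetMulOp (K := K) fun x => (W x)ᵀ) := by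
    refine Matrix.inv_eq_right_inv ?_
    have h1 : (1 - LinearMap.toMatrix' (jetMulOp (K := K) W) * LinearMap.toMatrix' (S ∘ₗ V) * LinearMap.toMatrix' (jetMulOp (K := K) fun x => (W x)ᵀ)) *
        LinearMap.toMatrix' (jetMulOp (K := K) W) = LinearMap.toMatrix' (jetMulOp (K := K) W) * (1 - LinearMap.toMatrix' (S ∘ₗ V)) := by
      rw [Matrix.sub_mul, Matrix.one_mul, Matrix.mul_sub, Matrix.mul_one, Matrix.mul_assoc, Matrix.mul_assoc, hJ'J, Matrix.mul_one]
    calc (1 - LinearMap.toMatrix' (jetMulOp (K := K) W) * LinearMap.toMatrix' (S ∘ₗ V) * LinearMap.toMatrix' (jetMulOp (K := K) fun x => (W x)ᵀ)) *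
          (LinearMap.toMatrix' (jetMulOp (K := K) W) * (1 - LinearMap.toMatrix' (S ∘ₗ V))⁻¹ * LinearMap.toMatrix' (jetMulOp (K := K) fun x => (W x)ᵀ))
        = ((1 - LinearMap.toMatrix' (jetMulOp (K := K) W) * LinearMap.toMatrix' (S ∘ₗ V) * LinearMap.toMatrix' (jetMulOp (K := K) fun x => (W x)ᵀ)) *
            LinearMap.toMatrix' (jetMulOp (K := K) W)) * (1 - LinearMap.toMatrix' (S ∘ₗ V))⁻¹ * LinearMap.toMatrix' (jetMulOp (K := K) fun x => (W x)ᵀ) := by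
          simp only [Matrix.mul_assoc]
      _ = LinearMap.toMatrix' (jetMulOp (K := K) W) * ((1 - LinearMap.toMatrix' (S ∘ₗ V)) * (1 - LinearMap.toMatrix' (S ∘ₗ V))⁻¹) *
            LinearMap.toMatrix' (jetMulOp (K := K) fun x => (W x)ᵀ) := by rw [h1]; simp only [Matrix.mul_assoc]
      _ = 1 := by rw [Matrix.mul_nonsing_inv _ ((Matrix.isUnit_iff_isUnit_det _).1 hunit), Matrix.mul_one, hJ]
  unfold bgPropV
  rw [hstep, hinv, LinearMap.toMatrix'_comp (jetMulOp W) (S ∘ₗ mmulOp fun x => (W x)ᵀ), LinearMap.toMatrix'_comp S (mmulOp fun x => (W x)ᵀ)]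
  have hfin : LinearMap.toMatrix' (jetMulOp (K := K) W) * (1 - LinearMap.toMatrix' (S ∘ₗ V))⁻¹ * LinearMap.toMatrix' (jetMulOp (K := K) fun x => (W x)ᵀ) *
        (LinearMap.toMatrix' (jetMulOp (K := K) W) * (LinearMap.toMatrix' S * LinearMap.toMatrix' (mmulOp fun x => (W x)ᵀ))) =
      LinearMap.toMatrix' (jetMulOp (K := K) W) * ((1 - LinearMap.toMatrix' (S ∘ₗ V))⁻¹ * LinearMap.toMatrix' S) * LinearMap.toMatrix' (mmulOp fun x => (W x)ᵀ) := by
    simp only [Matrix.mul_assoc]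
    rw [← Matrix.mul_assoc (LinearMap.toMatrix' (jetMulOp (K := K) fun x => (W x)ᵀ)) (LinearMap.toMatrix' (jetMulOp (K := K) W)), hJ'J, Matrix.one_mul]
  rw [hfin, Matrix.mulVecLin_mul, Matrix.mulVecLin_mul, mulVecLin_toMatrix', mulVecLin_toMatrix']
  rfl

/-- ★★ **EVERY COMPONENT OF THE DRESSED PAIR CONJUGATES**: `pr_k∘X̂(Ŝ^W, V̂^W) = M_W∘(pr_k∘X̂(Ŝ, V̂))∘M_{Wᵀ}`. [cite: Balaban1985BackgroundPropagators, (3.65) p.403, (3.35) p.396 (shapes)] -/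
theorem dressed_gaugeConj (hW : ∀ x, W x * (W x)ᵀ = 1) (hW' : ∀ x, (W x)ᵀ * W x = 1) (hunit : IsUnit (1 - LinearMap.toMatrix' (S ∘ₗ V))) (k : Option K) :
    projO k ∘ₗ bgPropV (jetMulOp W ∘ₗ S ∘ₗ mmulOp (fun x => (W x)ᵀ)) (mmulOp W ∘ₗ V ∘ₗ jetMulOp (fun x => (W x)ᵀ)) =
      mmulOp W ∘ₗ (projO k ∘ₗ bgPropV S V) ∘ₗ mmulOp (fun x => (W x)ᵀ) := by
  rw [bgPropV_gaugeConj W S V hW hW' hunit, ← LinearMap.comp_assoc, projO_comp_jetMulOp]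
  simp only [LinearMap.comp_assoc]

variable (G₀ : (X × ι → ℝ) →ₗ[ℝ] (X × ι → ℝ)) (D : K → (X × ι → ℝ) →ₗ[ℝ] (X × ι → ℝ))

/-- ★★ **n15-w3's DRESSED CUBE AT CONJUGATED DATA IS THE CONJUGATED DRESSED CUBE**: with the conjugated flat cube `M_WG₀M_{Wᵀ}`, conjugated derived pieces `M_WD_kM_{Wᵀ}` and the conjugated
jet perturbation `M_WV̂Ĵ_{Wᵀ}`, file 23's cube `pr₀∘bgPropV (stack · ·) ·` equals `M_W∘(pr₀∘bgPropV (stack G₀ D) V̂)∘M_{Wᵀ}` (`WWᵀ = WᵀW = 1`, unit hypothesis at the original data).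
[cite: Balaban1985BackgroundPropagators, (3.63)–(3.65) pp.402–403, (3.35) p.396 (shapes)] -/
theorem dressedCube_gaugeConj (hW : ∀ x, W x * (W x)ᵀ = 1) (hW' : ∀ x, (W x)ᵀ * W x = 1) (hunit : IsUnit (1 - LinearMap.toMatrix' (stack G₀ D ∘ₗ V))) (k : Option K) :
    projO k ∘ₗ bgPropV (stack (mmulOp W ∘ₗ G₀ ∘ₗ mmulOp (fun x => (W x)ᵀ)) (fun k => mmulOp W ∘ₗ D k ∘ₗ mmulOp (fun x => (W x)ᵀ))) (mmulOp W ∘ₗ V ∘ₗ jetMulOp (fun x => (W x)ᵀ)) =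
      mmulOp W ∘ₗ (projO k ∘ₗ bgPropV (stack G₀ D) V) ∘ₗ mmulOp (fun x => (W x)ᵀ) := by
  rw [stack_gaugeConj W G₀ D]
  exact dressed_gaugeConj W (stack G₀ D) V hW hW' hunit k

/-- The unit hypothesis of file 23 at the conjugated data follows from the one at the original data. [cite: Balaban1985BackgroundPropagators, (3.63)–(3.64) pp.402–403 (mechanism)] -/
theorem isUnit_dressedCube_gaugeConj (hW : ∀ x, W x * (W x)ᵀ = 1) (hW' : ∀ x, (W x)ᵀ * W x = 1) (hunit : IsUnit (1 - LinearMap.toMatrix' (stack G₀ D ∘ₗ V))) :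
    IsUnit (1 - LinearMap.toMatrix' (stack (mmulOp W ∘ₗ G₀ ∘ₗ mmulOp (fun x => (W x)ᵀ)) (fun k => mmulOp W ∘ₗ D k ∘ₗ mmulOp (fun x => (W x)ᵀ)) ∘ₗ
      (mmulOp W ∘ₗ V ∘ₗ jetMulOp (fun x => (W x)ᵀ)))) := by
  rw [stack_gaugeConj W G₀ D, step_gaugeConj W (stack G₀ D) V hW']
  exact isUnit_one_sub_gaugeConj W hW hW' hunit

end Neumann

end Summit.QuantumFields.YangMills.BalabanUVNodes.N15.CurvedSpecies

end
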